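import Summits.Ventures.PercRepro.C026HubThree

/-!
# Theorem H, part 4: the cell bookkeeping, (H3) and Corollary H (p6, gen 12)

The eight slices of `C026HubThree.lean` sum to mine-3's (H3) once the cells are re-counted:
`#{a ≁ b, b ≁ c} = #ac|b + #apart` (`card_sep_ab_bc_eq`), `#{a ≁ b, a ≁ c} = #bc|a + #apart`
(`card_sep_ab_ac_eq`), `#{c ≁ a, c ≁ b} = #ab|c + #apart` (`card_c_sep_eq`), `#Λ = #{c ≁ a, c ≁ b}`
by complement symmetry (`card_lambda_eq`), `#{a ~ b ∨ a ~ c} ∩ Λ = #N_AB + #X_a` (`card_nAB_or_ac_eq`)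
and Lemma Φ `#N_AB = #ab|c + #N²` (p5's `card_nAB_eq`):

* **(H3)** `Δ_CF(G + v_{abc}) = 4·Δ_CF(G) + #N² + #apart + (#ac|b − #X_a) + (#bc|a − #X_b)`
  (`slackCF_hub3_abc`), hence `4·Δ_CF(G) ≤ Δ_CF(G + v_{abc})` (`slackCF_hub3_abc_ge`);
* **Corollary H** (`slackCF_nonneg_hub3_abc`, with `slackCF_nonneg_hub2_ab / _ac / _bc` in
  `C026HubTwo.lean`): mine-3's (CF) is closed under attaching a hub of any type, the slack multiplied
  by at least `3` (`4` for the `abc`-hub).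
-/

namespace PercRepro

open Finset

namespace MultiGraph

section HubCorollary

variable {V E : Type*} [Fintype E] {G : MultiGraph V E}

/-! ### The cell bookkeeping -/

omit [Fintype E] in
/-- On `c ~ a`, `a ~ b` and `c ~ b` agree. -/
theorem conn_ab_iff_cb_of_ca {ω : Config E} {a b c : V} (hca : G.Conn ω c a) :
    G.Conn ω a b ↔ G.Conn ω c b :=
  ⟨fun h => hca.trans h, fun h => hca.symm.trans h⟩

open Classical in
/-- `#{a ≁ b, b ≁ c} = #ac|b + #apart`. -/
theorem card_sep_ab_bc_eq (a b c : V) :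
    (univ.filter fun ω : Config E => ¬ G.Conn ω a b ∧ ¬ G.Conn ω b c).card =
      (univ.filter fun ω : Config E => G.Conn ω c a ∧ ¬ G.Conn ω c b).card +
        (univ.filter fun ω : Config E => ¬ G.Conn ω a b ∧ ¬ G.Conn ω a c ∧ ¬ G.Conn ω b c).card := by
  rw [Finset.card_filter, Finset.card_filter, Finset.card_filter, ← Finset.sum_add_distrib]
  refine Finset.sum_congr rfl fun ω _ => ?_
  have hbc : G.Conn ω b c ↔ G.Conn ω c b := conn_comm
  have hac : G.Conn ω a c ↔ G.Conn ω c a := conn_comm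
  by_cases hca : G.Conn ω c a
  · have hiff := conn_ab_iff_cb_of_ca (G := G) (b := b) hca
    by_cases hcb : G.Conn ω c b
    · simp [hca, hcb, hiff.mpr hcb, hbc]
    · have hab : ¬ G.Conn ω a b := fun h => hcb (hiff.mp h)
      simp [hca, hcb, hab, hac, hbc]
  · simp [hca, hac, hbc]

open Classical in
/-- `#{a ≁ b, a ≁ c} = #bc|a + #apart`. -/
theorem card_sep_ab_ac_eq (a b c : V) :
    (univ.filter fun ω : Config E => ¬ G.Conn ω a b ∧ ¬ G.Conn ω a c).card =
      (univ.filter fun ω : Config E => G.Conn ω c b ∧ ¬ G.Conn ω c a).card +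
        (univ.filter fun ω : Config E => ¬ G.Conn ω a b ∧ ¬ G.Conn ω a c ∧ ¬ G.Conn ω b c).card := by
  rw [Finset.card_filter, Finset.card_filter, Finset.card_filter, ← Finset.sum_add_distrib]
  refine Finset.sum_congr rfl fun ω _ => ?_
  have hbc : G.Conn ω b c ↔ G.Conn ω c b := conn_comm
  have hac : G.Conn ω a c ↔ G.Conn ω c a := conn_comm
  by_cases hcb : G.Conn ω c b
  · have hiff := conn_ab_iff_ca_of_cb (G := G) (a := a) hcb
    by_cases hca : G.Conn ω c a
    · simp [hca, hcb, hiff.mpr hca, hbc]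
    · have hab : ¬ G.Conn ω a b := fun h => hca (hiff.mp h)
      simp [hca, hcb, hab, hac, hbc]
  · simp [hcb, hac, hbc]

open Classical in
/-- `#{c ≁ a, c ≁ b} = #ab|c + #apart`. -/
theorem card_c_sep_eq (a b c : V) :
    (univ.filter fun ω : Config E => ¬ G.Conn ω c a ∧ ¬ G.Conn ω c b).card =
      (univ.filter fun ω : Config E => G.Conn ω a b ∧ ¬ G.Conn ω a c).card +
        (univ.filter fun ω : Config E => ¬ G.Conn ω a b ∧ ¬ G.Conn ω a c ∧ ¬ G.Conn ω b c).card := by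
  rw [Finset.card_filter, Finset.card_filter, Finset.card_filter, ← Finset.sum_add_distrib]
  refine Finset.sum_congr rfl fun ω _ => ?_
  have hbc : G.Conn ω b c ↔ G.Conn ω c b := conn_comm
  have hac : G.Conn ω a c ↔ G.Conn ω c a := conn_comm
  by_cases hab : G.Conn ω a b
  · have hiff : G.Conn ω c a ↔ G.Conn ω c b := ⟨fun h => h.trans hab, fun h => h.trans hab.symm⟩
    by_cases hca : G.Conn ω c a
    · simp [hab, hca, hiff.mp hca, hac]
    · have hcb : ¬ G.Conn ω c b := fun h => hca (hiff.mpr h)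
      simp [hab, hca, hcb, hac]
  · simp [hab, hac, hbc]

open Classical in
/-- `#Λ = #{c ≁ a, c ≁ b}` (the complement bijection). -/
theorem card_lambda_eq (a b c : V) :
    (univ.filter fun ω : Config E => ¬ G.Conn ωᶜ c a ∧ ¬ G.Conn ωᶜ c b).card =
      (univ.filter fun ω : Config E => ¬ G.Conn ω c a ∧ ¬ G.Conn ω c b).card := by
  symm
  convert card_filter_compl (fun ω => ¬ G.Conn ω c a ∧ ¬ G.Conn ω c b) using 2 <;>
    (ext ω; simp only [Finset.mem_filter])

open Classical in
/-- **`#{a ~ b ∨ a ~ c} ∩ Λ = #N_AB + #X_a`** (`X_a = ac|b ∩ Λ`). -/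
theorem card_nAB_or_ac_eq (a b c : V) :
    (univ.filter fun ω : Config E =>
        (G.Conn ω a b ∨ G.Conn ω a c) ∧ ¬ G.Conn ωᶜ c a ∧ ¬ G.Conn ωᶜ c b).card =
      (univ.filter fun ω : Config E => G.Conn ω a b ∧ ¬ G.Conn ωᶜ c a ∧ ¬ G.Conn ωᶜ c b).card +
        (univ.filter fun ω : Config E =>
          G.Conn ω c a ∧ ¬ G.Conn ω c b ∧ ¬ G.Conn ωᶜ c a ∧ ¬ G.Conn ωᶜ c b).card := by
  rw [Finset.card_filter, Finset.card_filter, Finset.card_filter, ← Finset.sum_add_distrib]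
  refine Finset.sum_congr rfl fun ω _ => ?_
  have hac : G.Conn ω a c ↔ G.Conn ω c a := conn_comm
  by_cases hca : G.Conn ω c a
  · have hiff := conn_ab_iff_cb_of_ca (G := G) (b := b) hca
    by_cases hab : G.Conn ω a b
    · simp [hab, hca, hac, hiff.mp hab]
    · have hcb : ¬ G.Conn ω c b := fun h => hab (hiff.mpr h)
      simp [hab, hca, hcb, hac]
  · simp [hca, hac]

/-! ### (H3) and Corollary H -/

open Classical in
/-- **(H3)**: `Δ_CF(G + v_{abc}) = 4·Δ_CF(G) + #N² + #apart + (#ac|b − #X_a) + (#bc|a − #X_b)`. -/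
theorem slackCF_hub3_abc {v a b c : V} (hv : G.Isolated v) (hav : a ≠ v) (hbv : b ≠ v)
    (hcv : c ≠ v) :
    (G.hub3 v a b c).slackCF a b c =
      4 * G.slackCF a b c +
        ((univ.filter fun ω : Config E => G.NTwo ω a b c).card : ℤ) +
        ((univ.filter fun ω : Config E =>
          ¬ G.Conn ω a b ∧ ¬ G.Conn ω a c ∧ ¬ G.Conn ω b c).card : ℤ) +
        (((univ.filter fun ω : Config E => G.Conn ω c a ∧ ¬ G.Conn ω c b).card : ℤ) -
          ((univ.filter fun ω : Config E =>
            G.Conn ω c a ∧ ¬ G.Conn ω c b ∧ ¬ G.Conn ωᶜ c a ∧ ¬ G.Conn ωᶜ c b).card : ℤ)) +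
        (((univ.filter fun ω : Config E => G.Conn ω c b ∧ ¬ G.Conn ω c a).card : ℤ) -
          ((univ.filter fun ω : Config E =>
            G.Conn ω c b ∧ ¬ G.Conn ω c a ∧ ¬ G.Conn ωᶜ c a ∧ ¬ G.Conn ωᶜ c b).card : ℤ)) := by
  rw [slackCF_hub3_eq, sliceCF_hub3_fff hv hav hbv hcv, sliceCF_hub3_tff hv hav hbv hcv,
    sliceCF_hub3_ftf hv hav hbv hcv, sliceCF_hub3_fft hv hav hbv hcv,
    sliceCF_hub3_ttf hv hav hbv hcv, sliceCF_hub3_tft hv hav hbv hcv,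
    sliceCF_hub3_ftt hv hav hbv hcv, sliceCF_hub3_ttt hv hav hbv hcv, card_nAB_or_cb_eq,
    card_nAB_or_ac_eq]
  have hs : G.slackCF a b c =
      ((univ.filter fun ω : Config E => G.Conn ω a b ∧ ¬ G.Conn ω a c).card : ℤ) +
        ((univ.filter fun ω : Config E => G.Conn ω c a ∧ ¬ G.Conn ω c b).card : ℤ) +
        ((univ.filter fun ω : Config E => G.Conn ω c b ∧ ¬ G.Conn ω c a).card : ℤ) -
        ((univ.filter fun ω : Config E =>
          G.Conn ω a b ∧ ¬ G.Conn ωᶜ c a ∧ ¬ G.Conn ωᶜ c b).card : ℤ) := by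
    unfold slackCF
    rfl
  have h1 := card_sep_ab_bc_eq (G := G) a b c
  have h2 := card_sep_ab_ac_eq (G := G) a b c
  have h3 := card_c_sep_eq (G := G) a b c
  have h4 := card_lambda_eq (G := G) a b c
  have h5 := card_nAB_eq (G := G) a b c
  rw [hs]
  push_cast
  omega

/-- **(H3), the inequality**: `4·Δ_CF(G) ≤ Δ_CF(G + v_{abc})` (`X_a ⊆ ac|b`, `X_b ⊆ bc|a`). -/
theorem slackCF_hub3_abc_ge {v a b c : V} (hv : G.Isolated v) (hav : a ≠ v) (hbv : b ≠ v)
    (hcv : c ≠ v) : 4 * G.slackCF a b c ≤ (G.hub3 v a b c).slackCF a b c := by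
  classical
  rw [slackCF_hub3_abc hv hav hbv hcv]
  have hXa : (univ.filter fun ω : Config E =>
      G.Conn ω c a ∧ ¬ G.Conn ω c b ∧ ¬ G.Conn ωᶜ c a ∧ ¬ G.Conn ωᶜ c b).card ≤
      (univ.filter fun ω : Config E => G.Conn ω c a ∧ ¬ G.Conn ω c b).card := by
    apply Finset.card_le_card
    intro ω hω
    simp only [Finset.mem_filter, Finset.mem_univ, true_and] at hω ⊢
    exact ⟨hω.1, hω.2.1⟩
  have hXb : (univ.filter fun ω : Config E =>
      G.Conn ω c b ∧ ¬ G.Conn ω c a ∧ ¬ G.Conn ωᶜ c a ∧ ¬ G.Conn ωᶜ c b).card ≤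
      (univ.filter fun ω : Config E => G.Conn ω c b ∧ ¬ G.Conn ω c a).card := by
    apply Finset.card_le_card
    intro ω hω
    simp only [Finset.mem_filter, Finset.mem_univ, true_and] at hω ⊢
    exact ⟨hω.1, hω.2.1⟩
  omega

/-- **Corollary H for the `abc`-hub**: (CF) on `G` gives (CF) on `G + v_{abc}`. -/
theorem slackCF_nonneg_hub3_abc {v a b c : V} (hv : G.Isolated v) (hav : a ≠ v) (hbv : b ≠ v)
    (hcv : c ≠ v) (h : 0 ≤ G.slackCF a b c) : 0 ≤ (G.hub3 v a b c).slackCF a b c :=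
  le_trans (by omega) (slackCF_hub3_abc_ge hv hav hbv hcv)

end HubCorollary

end MultiGraph

end PercRepro
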